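import Summits.RiemannHypothesis.RiemannHypothesis.Theorems.Splittings.NbBddNatural
import HarnessLib

/-!
# Splittings / NB — the UNSMOOTHED Möbius truncation: `liminf_N I(M_N) < ∞ ⟹ RH` (census row V21)

Cell rh-split, seat rh-split-nb-neg g4 (card `SPLIT-nb-neg.md` §10, closing the prose row V21 of §9 in
kernel).  Family NB, integrand `I(N,a) = ∫⁻ ‖1 - ζ(1/2+it) Σ_{k<N} a_k (k+1)^{-(1/2+it)}‖² dt/(1/4+t²)`
verbatim; here `a_k = μ(k+1)`: the SHARP truncation `M_N(s) = Σ_{n≤N} μ(n) n^{-s}` of `1/ζ(s)` (no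
`(1 − log n/log N)` taper — the sums `S_n = Σ μ(k)ρ_k` of Báez-Duarte 2000 §4, which do NOT converge to
`−χ` in `L²`: `Literature.Barriers.RiemannHypothesis.BaezDuarte2000_prop4_4`).

* `cM_apply_of_le`, `norm_cM_le` — the coefficients of `ζ(s)M_N(s)`: `= [k=1]` for `k ≤ N` (every divisor
  of `k` is `≤ N`, `Σ_{d∣k} μ(d) = [k=1]`), `|·| ≤ d(k) ≤ k` beyond;
* `norm_zeta_mul_MN_sub_one_le` — on `Re s = 3`: `‖ζ(s)M_N(s) − 1‖ ≤ Σ_{k>N} k⁻²`, uniformly in `t`;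
* `sharpMoebius_lineDecay_three` — hence `sup_t ‖1 − ζ(3+it)M_N(3+it)‖ → 0`;
* `rh_of_frequently_bdd_sharpMoebius` — **if `I(M_N)` is bounded along a subsequence then RH**
  (g2's label lemma `NbBddNatural.rh_of_nbBdd_of_line` with `u = 3`); `rh_of_sharpMoebius_tailBdd` (a
  bounded tail `∀ N ≥ H, I(M_N) ≤ C₁` is RH on its own: FIN decoration); `rh_or_tendsto_sharpMoebius_atTop`
  (dichotomy: RH or `I(M_N) → ∞`).

LABEL (lens neg): C := «I(M_N) bounded frequently»: C ⟹ RH (kernel, RH-free proof, F1-free, FIN-free);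
RH ⟹ C is OPEN and numerically doubtful in print (Báez-Duarte 2000 Props 4.4–4.5: `‖χ + S_n‖ ≥
max(C|M(n)+2|/√n, |g(n)|√n)`, `g(n) = Σ_{k≤n} μ(k)/k`); as a TAIL conjunct of any FIN ∧ TAIL split: the tail
alone gives RH — decoration-or-corpse, exactly as the smoothed row V17/§8 but for the sharper object.

No definitions (the coefficient function is a section hypothesis `hw`, as in
`Splittings/NbBddNaturalLineDecay.lean`); RH-free; std axioms expected.
References: L. Báez-Duarte, arXiv:math/0011254 (2000), Props 4.4–4.5
(`Literature.Barriers.RiemannHypothesis.BaezDuarte2000_prop4_4/_4_5`); the three-lines label lemma is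
the tree's `Splittings.NbBddNatural.rh_of_nbBdd_of_line` (rh-split nb/neg g2).

HONEST LABEL: «SPLITTING SEARCH over kernel-typed RH-EQUIVALENCES; a splitting A ∧ B ⟹ RH is
CONDITIONAL bookkeeping unless A and B are both proved; nothing here bears on the truth of RH.»
-/

set_option linter.dupNamespace false

noncomputable section

open Complex MeasureTheory Set Filter Topology
open scoped Real ENNReal
open scoped LSeries.notation

namespace Summit.RiemannHypothesis.RiemannHypothesis.Theorems.Splittings.NbSharpMoebius

open Summit.RiemannHypothesis.RiemannHypothesis.Theorems.Splittings.NbBddNatural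

section SharpTruncation

/-! In this section `w` is the coefficient function of `M_N`: `w(n) = μ(n)` for `n ≤ N`, `0` beyond
(hypothesis `hw`; no definition is introduced). -/

variable {N : ℕ} {w : ℕ → ℂ}
  (hw : ∀ n : ℕ, w n = if n ≤ N then ((ArithmeticFunction.moebius n : ℝ) : ℂ) else 0)
include hw

/-- `|w(n)| ≤ 1`. [folklore] -/
private theorem norm_wM_le_one (n : ℕ) : ‖w n‖ ≤ 1 := by
  rw [hw]
  split_ifs with h
  · rw [Complex.norm_real, Real.norm_eq_abs]
    have : |ArithmeticFunction.moebius n| ≤ 1 := by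
      rw [ArithmeticFunction.abs_moebius]; split_ifs <;> norm_num
    rw [← Int.cast_abs]; exact_mod_cast this
  · simp

/-- `M_N(s)` (the `Fin N`-indexed sum of the card) is the L-series of `w`. [folklore] -/
theorem MN_eq_LSeries (s : ℂ) :
    ∑ n : Fin N, ((ArithmeticFunction.moebius (n + 1) : ℝ) : ℂ) * ((n : ℂ) + 1) ^ (-s) =
      LSeries w s := by
  have hsupp : ∀ k ∉ Finset.range (N + 1), LSeries.term w s k = 0 := by
    intro k hk
    rw [Finset.mem_range, not_lt] at hk
    rw [LSeries.term_of_ne_zero (by omega), hw, if_neg (by omega), zero_div]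
  rw [LSeries, tsum_eq_sum hsupp, Finset.sum_range_succ', LSeries.term_zero, add_zero,
    ← Fin.sum_univ_eq_sum_range]
  refine Finset.sum_congr rfl fun n _ ↦ ?_
  have hn : (n : ℕ) + 1 ≤ N := n.isLt
  rw [LSeries.term_of_ne_zero (Nat.succ_ne_zero _), hw, if_pos hn, cpow_neg, div_eq_mul_inv]
  push_cast
  ring

/-- The L-series of `w` converges absolutely on `Re s > 1`. [folklore] -/
private theorem LSeriesSummable_wM {s : ℂ} (hs : 1 < s.re) : LSeriesSummable w s :=
  LSeriesSummable_of_bounded_of_one_lt_re (fun n _ ↦ norm_wM_le_one hw n) hs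

/-- The coefficients of `ζ(s) M_N(s)` for `k ≤ N`: `(ζ ⋆ w)(k) = Σ_{d∣k} μ(d) = [k=1]` (every divisor of
`k ≤ N` is `≤ N`). [folklore] -/
theorem cM_apply_of_le {k : ℕ} (hkN : k ≤ N) :
    ((fun n ↦ (ArithmeticFunction.zeta n : ℂ)) ⍟ w) k = δ k := by
  rw [zeta_convolution_apply]
  have h1 : ∑ d ∈ k.divisors, w d = ∑ d ∈ k.divisors, ((ArithmeticFunction.moebius d : ℝ) : ℂ) := by
    refine Finset.sum_congr rfl fun d hd ↦ ?_
    have : d ≤ N := (Nat.divisor_le hd).trans hkN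
    rw [hw, if_pos this]
  have hμ : ∑ d ∈ k.divisors, (ArithmeticFunction.moebius d : ℝ) = if k = 1 then 1 else 0 := by
    have h := congrArg (fun f : ArithmeticFunction ℝ ↦ f k)
      (ArithmeticFunction.coe_moebius_mul_coe_zeta (R := ℝ))
    simp only [ArithmeticFunction.coe_mul_zeta_apply, ArithmeticFunction.intCoe_apply,
      ArithmeticFunction.one_apply] at h
    exact h
  rw [h1, ← Complex.ofReal_sum, hμ]
  simp only [LSeries.delta]
  split_ifs <;> push_cast <;> rfl

/-- For all `k`: `|(ζ ⋆ w)(k)| ≤ d(k) ≤ k`. [folklore] -/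
private theorem norm_cM_le (k : ℕ) : ‖((fun n ↦ (ArithmeticFunction.zeta n : ℂ)) ⍟ w) k‖ ≤ k := by
  rw [zeta_convolution_apply]
  calc ‖∑ d ∈ k.divisors, w d‖ ≤ ∑ d ∈ k.divisors, ‖w d‖ := norm_sum_le _ _
    _ ≤ ∑ d ∈ k.divisors, (1 : ℝ) := Finset.sum_le_sum fun d _ ↦ norm_wM_le_one hw d
    _ = k.divisors.card := by simp
    _ ≤ k := by exact_mod_cast Nat.card_divisors_le_self k

/-- The estimate on the line `Re s = 3`: `‖ζ(s)M_N(s) − 1‖ ≤ Σ_{k>N} k⁻²` (`N ≥ 1`). [folklore] -/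
theorem norm_zeta_mul_MN_sub_one_le (hN : 1 ≤ N) (t : ℝ) :
    ‖riemannZeta ((3 : ℝ) + t * I) * LSeries w ((3 : ℝ) + t * I) - 1‖ ≤
      ∑' k : ℕ, 1 / ((k + (N + 1) : ℕ) : ℝ) ^ 2 := by
  set s : ℂ := (3 : ℝ) + t * I with hs_def
  have hsre : s.re = 3 := by simp [hs_def]
  have hs1 : 1 < s.re := by rw [hsre]; norm_num
  have hζs : LSeriesSummable (fun n ↦ (ArithmeticFunction.zeta n : ℂ)) s :=
    ArithmeticFunction.LSeriesSummable_zeta_iff.mpr hs1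
  have hws := LSeriesSummable_wM hw hs1
  have hcs : LSeriesSummable ((fun n ↦ (ArithmeticFunction.zeta n : ℂ)) ⍟ w) s :=
    hζs.convolution hws
  have hδs := LSeriesSummable_delta_of_one_lt_re hs1
  have hprod : riemannZeta s * LSeries w s =
      LSeries ((fun n ↦ (ArithmeticFunction.zeta n : ℂ)) ⍟ w) s := by
    rw [← ArithmeticFunction.LSeries_zeta_eq_riemannZeta hs1, LSeries_convolution' hζs hws]
  have hone : (1 : ℂ) = LSeries δ s := by rw [LSeries_delta]; rfl
  rw [hprod, hone, ← LSeries_sub hcs hδs, LSeries]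
  set g : ℕ → ℝ := fun k ↦
    ‖LSeries.term (((fun n ↦ (ArithmeticFunction.zeta n : ℂ)) ⍟ w) - δ) s k‖ with hg_def
  have hgs : Summable g := (hcs.sub hδs).norm
  have h3 : (3 : ℝ) = ((3 : ℕ) : ℝ) := by norm_num
  -- head: the first `N+1` coefficients of `ζ M_N - 1` vanish
  have hfin : ∀ k ∈ Finset.range (N + 1), g k = 0 := by
    intro k hk
    have hkN : k ≤ N := by rw [Finset.mem_range] at hk; omega
    rcases Nat.eq_zero_or_pos k with rfl | hk0
    · simp [hg_def]
    · simp only [hg_def]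
      rw [LSeries.norm_term_eq, if_neg hk0.ne', Pi.sub_apply, cM_apply_of_le hw hkN, sub_self,
        norm_zero, zero_div]
  -- tail: `|c_k|/k³ ≤ 1/k²`
  have htail : ∀ j : ℕ, g (j + (N + 1)) ≤ 1 / ((j + (N + 1) : ℕ) : ℝ) ^ 2 := by
    intro j
    have hk1 : j + (N + 1) ≠ 1 := by omega
    have hk0 : j + (N + 1) ≠ 0 := by omega
    have hδ0 : δ (j + (N + 1)) = 0 := by simp [LSeries.delta, hk1]
    simp only [hg_def]
    rw [LSeries.norm_term_eq, if_neg hk0, Pi.sub_apply, hδ0, sub_zero, hsre, h3, Real.rpow_natCast]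
    calc ‖((fun n ↦ (ArithmeticFunction.zeta n : ℂ)) ⍟ w) (j + (N + 1))‖ /
          ((j + (N + 1) : ℕ) : ℝ) ^ 3
        ≤ ((j + (N + 1) : ℕ) : ℝ) / ((j + (N + 1) : ℕ) : ℝ) ^ 3 := by
          gcongr; exact norm_cM_le hw _
      _ = 1 / ((j + (N + 1) : ℕ) : ℝ) ^ 2 := by
          have hkpos : (0 : ℝ) < ((j + (N + 1) : ℕ) : ℝ) := by positivity
          field_simp
  have hgs' : Summable fun j ↦ g (j + (N + 1)) := (summable_nat_add_iff (N + 1)).mpr hgs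
  have hsq : Summable fun k : ℕ ↦ 1 / (k : ℝ) ^ 2 := Real.summable_one_div_nat_pow.mpr one_lt_two
  have hinv' : Summable fun j : ℕ ↦ 1 / ((j + (N + 1) : ℕ) : ℝ) ^ 2 :=
    (summable_nat_add_iff (f := fun k : ℕ ↦ 1 / (k : ℝ) ^ 2) (N + 1)).mpr hsq
  calc ‖∑' k, LSeries.term (((fun n ↦ (ArithmeticFunction.zeta n : ℂ)) ⍟ w) - δ) s k‖
        ≤ ∑' k, g k := norm_tsum_le_tsum_norm hgs
    _ = ∑ k ∈ Finset.range (N + 1), g k + ∑' j, g (j + (N + 1)) :=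
        (hgs.sum_add_tsum_nat_add (N + 1)).symm
    _ = ∑' j, g (j + (N + 1)) := by rw [Finset.sum_eq_zero hfin, zero_add]
    _ ≤ ∑' j : ℕ, 1 / ((j + (N + 1) : ℕ) : ℝ) ^ 2 := hgs'.tsum_le_tsum htail hinv'

end SharpTruncation

/-- `Σ_{k>N} k⁻² → 0`. [folklore] -/
theorem tendsto_tailBound :
    Tendsto (fun N : ℕ ↦ ∑' k : ℕ, 1 / ((k + (N + 1) : ℕ) : ℝ) ^ 2) atTop (𝓝 0) :=
  (tendsto_sum_nat_add (fun k : ℕ ↦ 1 / (k : ℝ) ^ 2)).comp (tendsto_add_atTop_nat 1)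

/-- nb/neg g4 (V21) — ARITHMETIC INPUT: on the line `Re s = 3` the sharp Möbius truncations
`M_N(s) = Σ_{n≤N} μ(n) n^{-s}` invert `ζ` uniformly, `sup_t ‖1 − ζ(3+it) M_N(3+it)‖ ≤ Σ_{k>N} k⁻² → 0`.
[folklore] -/
theorem sharpMoebius_lineDecay_three : ∀ ε : ℝ, 0 < ε → ∀ᶠ N : ℕ in atTop, ∀ t : ℝ,
    ‖1 - riemannZeta ((3 : ℝ) + t * I) * ∑ n : Fin N,
      ((ArithmeticFunction.moebius (n + 1) : ℝ) : ℂ) * ((n : ℂ) + 1) ^ (-((3 : ℝ) + t * I))‖ ≤ ε := by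
  intro ε hε
  filter_upwards [tendsto_tailBound.eventually (gt_mem_nhds hε), eventually_ge_atTop 1] with N hN hN1 t
  have hw : ∀ n : ℕ, (fun n : ℕ ↦ if n ≤ N then ((ArithmeticFunction.moebius n : ℝ) : ℂ) else 0) n =
      if n ≤ N then ((ArithmeticFunction.moebius n : ℝ) : ℂ) else 0 := fun n ↦ rfl
  rw [norm_sub_rev, MN_eq_LSeries hw]
  exact (norm_zeta_mul_MN_sub_one_le hw hN1 t).trans hN.le

/-- nb/neg g4 (V21) — **`liminf_N I(M_N) < ∞ ⟹ RH`.** If the Nyman–Beurling distances of the SHARP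
Möbius truncations `M_N = Σ_{n≤N} μ(n) n^{-s}` are bounded along a subsequence, the Riemann hypothesis
holds (g2's three-lines label lemma `rh_of_nbBdd_of_line` on the strip `[1/2+η, 3]`, the line-`3` decay
being `sharpMoebius_lineDecay_three`).  The converse is open and numerically doubtful
(`Literature.Barriers.RiemannHypothesis.BaezDuarte2000_prop4_4`). [cite: BaezDuarte2000, Props. 4.4–4.5] -/
theorem rh_of_frequently_bdd_sharpMoebius (C₁ : ℝ)
    (h : ∃ᶠ N : ℕ in atTop, ∫⁻ t : ℝ, ENNReal.ofReal (‖1 - riemannZeta (1 / 2 + t * Complex.I) *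
      ∑ n : Fin N, ((ArithmeticFunction.moebius (n + 1) : ℝ) : ℂ) * ((n : ℂ) + 1) ^ (-(1 / 2 + t * Complex.I))‖ ^ 2 /
          (1 / 4 + t ^ 2)) ≤ ENNReal.ofReal C₁) :
    RiemannHypothesis := by
  refine rh_of_nbBdd_of_line C₁ 3 (by norm_num) fun ε hε ↦ ?_
  obtain ⟨N, hN1, hN2⟩ := (h.and_eventually (sharpMoebius_lineDecay_three ε hε)).exists
  exact ⟨N, fun n : Fin N ↦ ((ArithmeticFunction.moebius (n + 1) : ℝ) : ℂ), hN1, hN2⟩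

/-- nb/neg g4 (V21): a bounded sharp-Möbius TAIL «`I(M_N) ≤ C₁` for all `N ≥ H`» is RH on its own — in any
FIN ∧ TAIL splitting with this tail the finite conjunct is decoration. [cite: BaezDuarte2000, Prop. 4.4] -/
theorem rh_of_sharpMoebius_tailBdd (C₁ : ℝ) (H : ℕ)
    (hB : ∀ N : ℕ, H ≤ N → ∫⁻ t : ℝ, ENNReal.ofReal (‖1 - riemannZeta (1 / 2 + t * Complex.I) *
      ∑ n : Fin N, ((ArithmeticFunction.moebius (n + 1) : ℝ) : ℂ) * ((n : ℂ) + 1) ^ (-(1 / 2 + t * Complex.I))‖ ^ 2 /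
          (1 / 4 + t ^ 2)) ≤ ENNReal.ofReal C₁) :
    RiemannHypothesis :=
  rh_of_frequently_bdd_sharpMoebius C₁
    (frequently_atTop.2 fun N ↦ ⟨max N H, le_max_left _ _, hB _ (le_max_right _ _)⟩)

/-- nb/neg g4 (V21): the dichotomy — RH, or `I(M_N) → ∞`. [cite: BaezDuarte2000, Prop. 4.4] -/
theorem rh_or_tendsto_sharpMoebius_atTop :
    RiemannHypothesis ∨ Tendsto (fun N : ℕ ↦ ∫⁻ t : ℝ, ENNReal.ofReal (‖1 - riemannZeta (1 / 2 + t * Complex.I) *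
      ∑ n : Fin N, ((ArithmeticFunction.moebius (n + 1) : ℝ) : ℂ) * ((n : ℂ) + 1) ^ (-(1 / 2 + t * Complex.I))‖ ^ 2 /
          (1 / 4 + t ^ 2))) atTop (𝓝 ∞) := by
  by_cases hT : Tendsto (fun N : ℕ ↦ ∫⁻ t : ℝ, ENNReal.ofReal (‖1 - riemannZeta (1 / 2 + t * Complex.I) *
      ∑ n : Fin N, ((ArithmeticFunction.moebius (n + 1) : ℝ) : ℂ) * ((n : ℂ) + 1) ^ (-(1 / 2 + t * Complex.I))‖ ^ 2 /
          (1 / 4 + t ^ 2))) atTop (𝓝 ∞)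
  · exact Or.inr hT
  · left
    rw [ENNReal.tendsto_nhds_top_iff_nnreal] at hT
    push Not at hT
    obtain ⟨x, hx⟩ := hT
    refine rh_of_frequently_bdd_sharpMoebius x ?_
    refine hx.mono fun N hN ↦ ?_
    rwa [ENNReal.ofReal_coe_nnreal]

end Summit.RiemannHypothesis.RiemannHypothesis.Theorems.Splittings.NbSharpMoebius

end
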